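import Summits.SmoothPoincare4.SmoothPoincare4.Theorems.EntropyRungSubcylindricalRecognitionConeAnnulusArithmeticAux3
import HarnessLib

/-!
# Gaussian annulus arithmetic in `ℝ⁴` — stub `stub_coneAnnulusArithmetic`

Stub `stub_coneAnnulusArithmetic` of line `ancient-sphere-rigidity` (reshape r5) for the crux
`EntropyRung.SubcylindricalRecognition` (stmt-SmoothPoincare4-10869): the purely real-analytic
statement behind the exclusion of an orbifold cone point `ℝ⁴/Γ`, `|Γ| = k`, of a blow-down
shrinker — the value of Perelman's `𝒲`-functional on the `Γ`-invariant Gaussian annulus test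
function `w = e^{-ρ/8τ} cut(ρ)` tends to `-log k`.

## Statement

With `w(s) = e^{-s/8τ} cut(s)`, `cut(s) = T(s/(2ε²) - 1) T(3 - 4s/r'²)` (`T = Real.smoothTransition`),
`A = {ε < |y| < r'} ⊂ ℝ⁴`, `I₀ = ∫_A w(|y|²)²`, `I₁ = ∫_A 16|y|² w'(|y|²)²/(1-η)`,
`I₂ = ∫_A -w² log w²`: for `k ≥ 1` and `m > -log k` there are `η₀, c > 0` such that whenever
`0 ≤ η ≤ η₀`, `Λτ ≤ c`, `ε² ≤ cτ`, `τ ≤ c r'²` and `(1-η)² I₀ ≤ k J₀ ≤ (1+η)² I₀`,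
`0 ≤ k J₁ ≤ (1+η)² I₁`, `0 ≤ k J₂ ≤ (1+η)² I₂`, then
`τΛ + (τJ₁ + J₂)/J₀ + log J₀ - 2 log(4πτ) - 4 < m`.

## Proof

`…Aux3.lean` gives `I₀ ≤ P := 16π²τ²`, `P(1 - Lc) ≤ I₀`, `τ (1-η) I₁ ≤ P(2 + Lc)`, `I₂ ≤ P(2 + Lc)`
with `L = 12384 D² + 9225` (`D` a bound for `|T'|`; `budget`). The bookkeeping lemma
(`bookkeeping`): with `θ = Lc`, `(τ k J₁ + k J₂)/(k J₀) ≤ (1+η)²(2+θ)(2-η)/((1-η)³(1-θ)) ≤ 4 + 40δ`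
once `η, θ ≤ δ ≤ 1/100`, `log J₀ - log P ≤ 2 log(1+η) - log k ≤ 2η - log k`, `τΛ ≤ c ≤ δ`, so the
left side is `≤ 43δ - log k < m` for `δ = min(1/100, (m + log k)/44)`; finally `η₀ = δ`,
`c = min(1/4, δ/L)` (`c ≤ 1/4` gives `16ε² ≤ r'²`, needed for the shells not to overlap).

All statements are [folklore]; no named facts are used (Mathlib only).
-/

-- the prescribed namespace `Summit.<P>.<Sub>.…` duplicates `SmoothPoincare4` (P = Sub)
set_option linter.dupNamespace false

noncomputable section

open scoped Topology
open Set Real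
open MeasureTheory

namespace Summit.SmoothPoincare4.SmoothPoincare4.Theorems.SubcylindricalRecognition.AncientSphereRigidity

namespace ConeAnnulus

/-- Bulk budget: `(P/(1-c)² - P)/c ≤ P (2 + 8c)` for `0 < c ≤ 1/4`, `P ≥ 0`. [folklore] -/
theorem budget_bulk {P c : ℝ} (hP : 0 ≤ P) (hc : 0 < c) (hc4 : c ≤ 1 / 4) :
    (P / (1 - c) ^ 2 - P) / c ≤ P * (2 + 8 * c) := by
  have h1c : 0 < (1 - c) ^ 2 := by nlinarith
  rw [div_le_iff₀ hc, sub_le_iff_le_add, div_le_iff₀ h1c]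
  have : 1 ≤ (c * (2 + 8 * c) + 1) * (1 - c) ^ 2 := by nlinarith [mul_pos hc hc, sq_nonneg c]
  nlinarith [mul_le_mul_of_nonneg_left this hP]

/-- The error budget: with `L = 12384 D² + 9225`, `ε² ≤ cτ`, `τ ≤ c r'²`, `0 < c ≤ 1/4`, the integral
estimates give `16π²τ²(1 - Lc) ≤ I₀`, `τ I₁ ≤ 16π²τ² (2 + Lc)`, `I₂ ≤ 16π²τ² (2 + Lc)`. [folklore] -/
theorem budget {D c τ ε r' I₀ I₁ I₂ : ℝ} (hc : 0 < c) (hc4 : c ≤ 1 / 4) (hτ : 0 < τ)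
    (hε : 0 < ε) (hr : 0 < r') (hεc : ε ^ 2 ≤ c * τ) (hτc : τ ≤ c * r' ^ 2)
    (h0 : 16 * π ^ 2 * τ ^ 2 - exp 1 * (16 * π ^ 2 * ε ^ 4) -
        exp (-r' ^ 2 / (16 * τ)) * (64 * π ^ 2 * τ ^ 2) ≤ I₀)
    (h1 : I₁ ≤ 1 / τ * ((16 * π ^ 2 * τ ^ 2 / (1 - c) ^ 2 - 16 * π ^ 2 * τ ^ 2) / c) +
        (32 * D ^ 2 / ε ^ 2 + 2 * ε ^ 2 / τ ^ 2) * (exp 1 * (16 * π ^ 2 * ε ^ 4)) +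
        exp (-r' ^ 2 / (8 * τ)) * (512 * D ^ 2 / r' ^ 2 + r' ^ 2 / (2 * τ ^ 2)) *
          (exp 1 * (π ^ 2 * r' ^ 4)))
    (h2 : I₂ ≤ (16 * π ^ 2 * τ ^ 2 / (1 - c) ^ 2 - 16 * π ^ 2 * τ ^ 2) / c +
        exp 1 * (16 * π ^ 2 * ε ^ 4) + exp (-r' ^ 2 / (16 * τ)) * (64 * π ^ 2 * τ ^ 2)) :
    16 * π ^ 2 * τ ^ 2 * (1 - (12384 * D ^ 2 + 9225) * c) ≤ I₀ ∧
      τ * I₁ ≤ 16 * π ^ 2 * τ ^ 2 * (2 + (12384 * D ^ 2 + 9225) * c) ∧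
      I₂ ≤ 16 * π ^ 2 * τ ^ 2 * (2 + (12384 * D ^ 2 + 9225) * c) := by
  have he3 : exp 1 ≤ 3 := exp_one_lt_three.le
  have hP : 0 < 16 * π ^ 2 * τ ^ 2 := by positivity
  have hR : 0 < r' ^ 2 := by positivity
  have hτR : τ / r' ^ 2 ≤ c := by rwa [div_le_iff₀ hR]
  have hD2 : 0 ≤ D ^ 2 := sq_nonneg D
  -- (a) the inner Gaussian tail
  have hTa : exp 1 * (16 * π ^ 2 * ε ^ 4) ≤ 16 * π ^ 2 * τ ^ 2 * c := by
    have h4 : (ε ^ 2) ^ 2 ≤ (c * τ) ^ 2 := pow_le_pow_left₀ (by positivity) hεc 2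
    calc exp 1 * (16 * π ^ 2 * ε ^ 4) = exp 1 * (16 * π ^ 2 * (ε ^ 2) ^ 2) := by ring
      _ ≤ 3 * (16 * π ^ 2 * (c * τ) ^ 2) := by gcongr
      _ = 16 * π ^ 2 * τ ^ 2 * c * (3 * c) := by ring
      _ ≤ 16 * π ^ 2 * τ ^ 2 * c * 1 := by
          apply mul_le_mul_of_nonneg_left (by linarith) (by positivity)
      _ = _ := by ring
  -- (b) the outer Gaussian tail
  have hTb : exp (-r' ^ 2 / (16 * τ)) * (64 * π ^ 2 * τ ^ 2) ≤ 16 * π ^ 2 * τ ^ 2 * (64 * c) := by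
    have := exp_neg_div_sixteen_le hR hτ
    calc exp (-r' ^ 2 / (16 * τ)) * (64 * π ^ 2 * τ ^ 2)
        ≤ 16 * τ / r' ^ 2 * (64 * π ^ 2 * τ ^ 2) := by gcongr
      _ = 16 * π ^ 2 * τ ^ 2 * (64 * (τ / r' ^ 2)) := by ring
      _ ≤ 16 * π ^ 2 * τ ^ 2 * (64 * c) := by gcongr
  have hTc := budget_bulk hP.le hc hc4
  have hTd := budget_inner (D := D) hc hc4 hτ hε hεc
  have hTe := budget_outer (D := D) hc hτ hr hτc
  refine ⟨?_, ?_, ?_⟩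
  · -- I₀
    have : 16 * π ^ 2 * τ ^ 2 * (1 - (12384 * D ^ 2 + 9225) * c) ≤
        16 * π ^ 2 * τ ^ 2 - 16 * π ^ 2 * τ ^ 2 * c - 16 * π ^ 2 * τ ^ 2 * (64 * c) := by
      nlinarith [mul_nonneg hD2 hc.le, mul_pos hP hc]
    linarith
  · -- τ I₁
    have h1' := mul_le_mul_of_nonneg_left h1 hτ.le
    have e : τ * (1 / τ * ((16 * π ^ 2 * τ ^ 2 / (1 - c) ^ 2 - 16 * π ^ 2 * τ ^ 2) / c) +
        (32 * D ^ 2 / ε ^ 2 + 2 * ε ^ 2 / τ ^ 2) * (exp 1 * (16 * π ^ 2 * ε ^ 4)) +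
        exp (-r' ^ 2 / (8 * τ)) * (512 * D ^ 2 / r' ^ 2 + r' ^ 2 / (2 * τ ^ 2)) *
          (exp 1 * (π ^ 2 * r' ^ 4))) =
        (16 * π ^ 2 * τ ^ 2 / (1 - c) ^ 2 - 16 * π ^ 2 * τ ^ 2) / c +
        τ * ((32 * D ^ 2 / ε ^ 2 + 2 * ε ^ 2 / τ ^ 2) * (exp 1 * (16 * π ^ 2 * ε ^ 4))) +
        τ * (exp (-r' ^ 2 / (8 * τ)) * (512 * D ^ 2 / r' ^ 2 + r' ^ 2 / (2 * τ ^ 2)) *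
          (exp 1 * (π ^ 2 * r' ^ 4))) := by
      field_simp
    rw [e] at h1'
    have : (16 * π ^ 2 * τ ^ 2 / (1 - c) ^ 2 - 16 * π ^ 2 * τ ^ 2) / c +
        τ * ((32 * D ^ 2 / ε ^ 2 + 2 * ε ^ 2 / τ ^ 2) * (exp 1 * (16 * π ^ 2 * ε ^ 4))) +
        τ * (exp (-r' ^ 2 / (8 * τ)) * (512 * D ^ 2 / r' ^ 2 + r' ^ 2 / (2 * τ ^ 2)) *
          (exp 1 * (π ^ 2 * r' ^ 4))) ≤
        16 * π ^ 2 * τ ^ 2 * (2 + (12384 * D ^ 2 + 9225) * c) := by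
      have : 16 * π ^ 2 * τ ^ 2 * (2 + 8 * c) + 16 * π ^ 2 * τ ^ 2 * ((96 * D ^ 2 + 1) * c) +
          16 * π ^ 2 * τ ^ 2 * ((12288 * D ^ 2 + 9216) * c) =
          16 * π ^ 2 * τ ^ 2 * (2 + (12384 * D ^ 2 + 9225) * c) := by ring
      linarith
    linarith
  · -- I₂
    have : 16 * π ^ 2 * τ ^ 2 * (2 + 8 * c) + 16 * π ^ 2 * τ ^ 2 * c +
        16 * π ^ 2 * τ ^ 2 * (64 * c) ≤ 16 * π ^ 2 * τ ^ 2 * (2 + (12384 * D ^ 2 + 9225) * c) := by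
      nlinarith [mul_nonneg hD2 hc.le, mul_pos hP hc]
    linarith

/-! ## The final bookkeeping -/

/-- Single-variable core of the bookkeeping: `2(1+δ)²(2+δ) ≤ (4 + 40δ)(1-δ)⁴` for
`0 ≤ δ ≤ 1/100`. [folklore] -/
theorem bookkeeping_poly {δ : ℝ} (h0 : 0 ≤ δ) (h1 : δ ≤ 1 / 100) :
    2 * (1 + δ) ^ 2 * (2 + δ) ≤ (4 + 40 * δ) * (1 - δ) ^ 4 := by
  nlinarith [mul_nonneg h0 (show 0 ≤ 14 - 144 * δ by linarith),
    mul_nonneg (pow_nonneg h0 3) (show 0 ≤ 222 - 156 * δ by linarith), pow_nonneg h0 5,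
    pow_nonneg h0 2, pow_nonneg h0 4]

/-- The final bookkeeping: if `P(1-θ) ≤ I₀ ≤ P`, `B₁, B₂ ≤ P(2+θ)`,
`(1-η)² I₀ ≤ κ J₀ ≤ (1+η)² I₀`, `0 ≤ T₁`, `κ T₁ (1-η) ≤ (1+η)² B₁`, `0 ≤ J₂`, `κ J₂ ≤ (1+η)² B₂`
with `η, θ, a ≤ δ = δ(gap)` small, then `a + (T₁ + J₂)/J₀ + log J₀ - log P - 4 < -log κ + gap`.
[folklore] -/
theorem bookkeeping {gap : ℝ} (hgap : 0 < gap) :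
    ∃ δ : ℝ, 0 < δ ∧ δ ≤ 1 / 100 ∧ ∀ (η θ a P κ I₀ B₁ B₂ J₀ T₁ J₂ : ℝ),
      0 ≤ η → η ≤ δ → 0 ≤ θ → θ ≤ δ → a ≤ δ → 0 < P → 0 < κ →
      P * (1 - θ) ≤ I₀ → I₀ ≤ P → B₁ ≤ P * (2 + θ) → B₂ ≤ P * (2 + θ) →
      (1 - η) ^ 2 * I₀ ≤ κ * J₀ → κ * J₀ ≤ (1 + η) ^ 2 * I₀ →
      0 ≤ T₁ → κ * T₁ * (1 - η) ≤ (1 + η) ^ 2 * B₁ →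
      0 ≤ J₂ → κ * J₂ ≤ (1 + η) ^ 2 * B₂ →
      a + (T₁ + J₂) / J₀ + log J₀ - log P - 4 < -log κ + gap := by
  refine ⟨min (1 / 100) (gap / 44), by positivity, min_le_left _ _, ?_⟩
  intro η θ a P κ I₀ B₁ B₂ J₀ T₁ J₂ hη0 hηδ hθ0 hθδ haδ hP hκ hI0l hI0u hB1 hB2 hJ0l hJ0u hT1 hT1u
    hJ2 hJ2u
  have hδ1 : min (1 / 100) (gap / 44) ≤ 1 / 100 := min_le_left _ _
  have hδ2 : min (1 / 100) (gap / 44) ≤ gap / 44 := min_le_right _ _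
  set δ := min (1 / 100) (gap / 44) with hδ
  have hδ0 : 0 ≤ δ := hη0.trans hηδ
  have hη1 : η ≤ 1 / 100 := hηδ.trans hδ1
  have hθ1 : θ ≤ 1 / 100 := hθδ.trans hδ1
  have h1η : 0 < 1 - η := by linarith
  -- positivity of `I₀`, `J₀`
  have hI0pos : 0 < I₀ := by nlinarith
  have hMl : (1 - η) ^ 2 * (P * (1 - θ)) ≤ κ * J₀ :=
    (mul_le_mul_of_nonneg_left hI0l (sq_nonneg _)).trans hJ0l
  have hM : 0 < κ * J₀ := by
    have : 0 < (1 - η) ^ 2 * (P * (1 - θ)) := by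
      apply mul_pos (pow_pos h1η 2); nlinarith
    linarith
  have hJ0pos : 0 < J₀ := pos_of_mul_pos_right hM hκ.le
  -- the quotient
  have hquot : (T₁ + J₂) / J₀ ≤ 4 + 40 * δ := by
    rw [← mul_div_mul_left _ _ hκ.ne', mul_add, div_le_iff₀ hM]
    -- numerator times `(1 - η)`
    have hN : (κ * T₁ + κ * J₂) * (1 - η) ≤ (1 + η) ^ 2 * (P * (2 + θ)) * (2 - η) := by
      have h1 : (1 + η) ^ 2 * B₁ ≤ (1 + η) ^ 2 * (P * (2 + θ)) :=
        mul_le_mul_of_nonneg_left hB1 (sq_nonneg _)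
      have h2 : κ * J₂ * (1 - η) ≤ (1 + η) ^ 2 * (P * (2 + θ)) * (1 - η) := by
        apply mul_le_mul_of_nonneg_right _ h1η.le
        exact hJ2u.trans (mul_le_mul_of_nonneg_left hB2 (sq_nonneg _))
      nlinarith
    -- the polynomial inequality, reduced to one variable
    have hpoly : (1 + η) ^ 2 * (2 + θ) * (2 - η) ≤ (4 + 40 * δ) * ((1 - η) ^ 3 * (1 - θ)) := by
      have hL : (1 + η) ^ 2 * (2 + θ) * (2 - η) ≤ 2 * (1 + δ) ^ 2 * (2 + δ) := by
        have e1 : (1 + η) ^ 2 ≤ (1 + δ) ^ 2 := pow_le_pow_left₀ (by linarith) (by linarith) 2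
        have e2 : (2 + θ) * (2 - η) ≤ (2 + δ) * 2 := by
          exact mul_le_mul (by linarith) (by linarith) (by linarith) (by linarith)
        calc (1 + η) ^ 2 * (2 + θ) * (2 - η) = (1 + η) ^ 2 * ((2 + θ) * (2 - η)) := by ring
          _ ≤ (1 + δ) ^ 2 * ((2 + δ) * 2) :=
              mul_le_mul e1 e2 (by nlinarith) (sq_nonneg _)
          _ = 2 * (1 + δ) ^ 2 * (2 + δ) := by ring
      have hR : (4 + 40 * δ) * (1 - δ) ^ 4 ≤ (4 + 40 * δ) * ((1 - η) ^ 3 * (1 - θ)) := by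
        apply mul_le_mul_of_nonneg_left _ (by positivity)
        have e1 : (1 - δ) ^ 3 ≤ (1 - η) ^ 3 := pow_le_pow_left₀ (by linarith) (by linarith) 3
        calc (1 - δ) ^ 4 = (1 - δ) ^ 3 * (1 - δ) := by ring
          _ ≤ (1 - η) ^ 3 * (1 - θ) :=
              mul_le_mul e1 (by linarith) (by linarith) (pow_nonneg h1η.le 3)
      linarith [bookkeeping_poly hδ0 hδ1]
    have hPθ : 0 ≤ P * (2 + θ) := by positivity
    -- assemble: N (1-η) ≤ P · poly ≤ (4 + 40δ) M (1-η)
    have key : (κ * T₁ + κ * J₂) * (1 - η) ≤ (4 + 40 * δ) * (κ * J₀) * (1 - η) := by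
      calc (κ * T₁ + κ * J₂) * (1 - η) ≤ (1 + η) ^ 2 * (P * (2 + θ)) * (2 - η) := hN
        _ = P * ((1 + η) ^ 2 * (2 + θ) * (2 - η)) := by ring
        _ ≤ P * ((4 + 40 * δ) * ((1 - η) ^ 3 * (1 - θ))) :=
            mul_le_mul_of_nonneg_left hpoly hP.le
        _ = (4 + 40 * δ) * ((1 - η) ^ 2 * (P * (1 - θ))) * (1 - η) := by ring
        _ ≤ (4 + 40 * δ) * (κ * J₀) * (1 - η) := by
            apply mul_le_mul_of_nonneg_right _ h1η.le
            exact mul_le_mul_of_nonneg_left hMl (by positivity)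
    exact le_of_mul_le_mul_right key h1η
  -- the logarithm
  have hlog : log J₀ - log P ≤ 2 * η - log κ := by
    have hJ : J₀ ≤ (1 + η) ^ 2 * P / κ := by
      rw [le_div_iff₀ hκ]; nlinarith [sq_nonneg (1 + η)]
    have h1 : log J₀ ≤ log ((1 + η) ^ 2 * P / κ) := log_le_log hJ0pos hJ
    rw [log_div (by positivity) hκ.ne', log_mul (by positivity) hP.ne', log_pow] at h1
    have h2 : log (1 + η) ≤ η := by
      have := log_le_sub_one_of_pos (show 0 < 1 + η by linarith); linarith
    push_cast at h1
    linarith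
  -- conclusion
  have : 43 * δ < gap := by
    have : δ ≤ gap / 44 := hδ2
    linarith
  linarith

end ConeAnnulus

/-! ## The stub -/

open ConeAnnulus MeasureTheory in
/-- **Stub 6** of line `ancient-sphere-rigidity` — the Gaussian annulus arithmetic in `ℝ⁴` (the
localised form of `μ(ℝ⁴/Γ) = -log |Γ|`): with the profile `w(s) = e^{-s/8τ} cut(s)`,
`cut(s) = T(s/(2ε²) - 1) · T(3 - 4s/r'²)` (`T` = `Real.smoothTransition`; support in `[2ε², 3r'²/4]`, `= 1` on
`[4ε², r'²/2]`), and `I₀ = ∫_A w(|y|²)² dy`, `I₁ = ∫_A 16|y|² w'(|y|²)²/(1-η) dy`, `I₂ = ∫_A -w² log w² (|y|²) dy`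
over the annulus `A = {ε < |y| < r'}`, any reals `J₀, J₁, J₂` with `(1-η)² I₀ ≤ k J₀ ≤ (1+η)² I₀`,
`0 ≤ k J₁ ≤ (1+η)² I₁`, `0 ≤ k J₂ ≤ (1+η)² I₂` satisfy
`τΛ + (τ J₁ + J₂)/J₀ + log J₀ - 2 log(4πτ) - 4 < m` as soon as `m > -log k` and `η, Λτ, ε²/τ, τ/r'²` are
below thresholds depending only on `k, m` (main terms: `∫ e^{-|y|²/4τ} = 16π²τ²`,
`∫ (|y|²/4τ) e^{-|y|²/4τ} = 2 · 16π²τ²`). [folklore] -/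
theorem stub_coneAnnulusArithmetic :
    ∀ (k : ℕ), 1 ≤ k → ∀ m : ℝ, -Real.log k < m →
      ∃ η₀ : ℝ, 0 < η₀ ∧ ∃ c : ℝ, 0 < c ∧
        ∀ (η τ Λ ε r' : ℝ), 0 ≤ η → η ≤ η₀ → 0 < τ → 0 ≤ Λ → Λ * τ ≤ c →
          0 < ε → ε ^ 2 ≤ c * τ → 0 < r' → τ ≤ c * r' ^ 2 →
          ∀ (J₀ J₁ J₂ : ℝ),
            (1 - η) ^ 2 *
                (∫ y in (Metric.ball (0 : EuclideanSpace ℝ (Fin 4)) r' \ Metric.closedBall 0 ε),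
                  (Real.exp (-‖y‖ ^ 2 / (8 * τ)) *
                    (Real.smoothTransition (‖y‖ ^ 2 / (2 * ε ^ 2) - 1) *
                      Real.smoothTransition (3 - 4 * ‖y‖ ^ 2 / r' ^ 2))) ^ 2 ∂volume) ≤ k * J₀ →
            k * J₀ ≤ (1 + η) ^ 2 *
                (∫ y in (Metric.ball (0 : EuclideanSpace ℝ (Fin 4)) r' \ Metric.closedBall 0 ε),
                  (Real.exp (-‖y‖ ^ 2 / (8 * τ)) *
                    (Real.smoothTransition (‖y‖ ^ 2 / (2 * ε ^ 2) - 1) *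
                      Real.smoothTransition (3 - 4 * ‖y‖ ^ 2 / r' ^ 2))) ^ 2 ∂volume) →
            0 ≤ J₁ →
            k * J₁ ≤ (1 + η) ^ 2 *
                (∫ y in (Metric.ball (0 : EuclideanSpace ℝ (Fin 4)) r' \ Metric.closedBall 0 ε),
                  16 * ‖y‖ ^ 2 *
                    (deriv (fun s : ℝ ↦ Real.exp (-s / (8 * τ)) *
                      (Real.smoothTransition (s / (2 * ε ^ 2) - 1) *
                        Real.smoothTransition (3 - 4 * s / r' ^ 2))) (‖y‖ ^ 2)) ^ 2 / (1 - η) ∂volume) →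
            0 ≤ J₂ →
            k * J₂ ≤ (1 + η) ^ 2 *
                (∫ y in (Metric.ball (0 : EuclideanSpace ℝ (Fin 4)) r' \ Metric.closedBall 0 ε),
                  -((Real.exp (-‖y‖ ^ 2 / (8 * τ)) *
                      (Real.smoothTransition (‖y‖ ^ 2 / (2 * ε ^ 2) - 1) *
                        Real.smoothTransition (3 - 4 * ‖y‖ ^ 2 / r' ^ 2))) ^ 2 *
                    Real.log ((Real.exp (-‖y‖ ^ 2 / (8 * τ)) *
                      (Real.smoothTransition (‖y‖ ^ 2 / (2 * ε ^ 2) - 1) *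
                        Real.smoothTransition (3 - 4 * ‖y‖ ^ 2 / r' ^ 2))) ^ 2)) ∂volume) →
            τ * Λ + (τ * J₁ + J₂) / J₀ + Real.log J₀ - 2 * Real.log (4 * Real.pi * τ) - 4 < m := by
  intro k hk m hm
  -- the bound `D` for `|T'|` and the error constant `L`
  obtain ⟨D, hD0, hD⟩ := exists_bound_deriv_smoothTransition
  set L : ℝ := 12384 * D ^ 2 + 9225 with hL
  have hLpos : 0 < L := by positivity
  -- the bookkeeping threshold
  have hgap : 0 < m + Real.log k := by linarith
  obtain ⟨δ, hδ, hδ1, hbook⟩ := bookkeeping hgap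
  refine ⟨δ, hδ, min (1 / 4) (δ / L), by positivity, ?_⟩
  intro η τ Λ ε r' hη0 hηδ hτ hΛ hΛc hε hεc hr hτc J₀ J₁ J₂ h0l h0u hJ1 h1 hJ2 h2
  set c := min (1 / 4) (δ / L) with hc
  have hc0 : 0 < c := by positivity
  have hc4 : c ≤ 1 / 4 := min_le_left _ _
  have hcL : c ≤ δ / L := min_le_right _ _
  have hLc : L * c ≤ δ := by rwa [le_div_iff₀' hLpos] at hcL
  have hcδ : c ≤ δ := by
    have : δ / L ≤ δ := div_le_self hδ.le (by linarith [sq_nonneg D])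
    linarith
  have hη1 : η < 1 := by linarith
  have h1η : 0 < 1 - η := by linarith
  -- `16 ε² ≤ r'²`
  have hεr : 16 * ε ^ 2 ≤ r' ^ 2 := by
    have : ε ^ 2 ≤ c * (c * r' ^ 2) := hεc.trans (by gcongr)
    nlinarith [sq_nonneg r']
  -- the integral estimates and the budget
  have hc1 : c < 1 := by linarith
  obtain ⟨hI0, hI1, hI2⟩ := budget (D := D) hc0 hc4 hτ hε hr hεc hτc (I0_ge hτ hε hr)
    (I1_le hD hc0 hc1 hτ hε hr hεr) (I2_le hc0 hc1 hτ hε hr)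
  have hI0u := I0_le ε r' hτ
  -- rewrite `I₁` with the constant `1/(1-η)` pulled out
  rw [integral_div] at h1
  have h1' : (k : ℝ) * (τ * J₁) * (1 - η) ≤ (1 + η) ^ 2 * (τ *
      ∫ y in (Metric.ball (0 : EuclideanSpace ℝ (Fin 4)) r' \ Metric.closedBall 0 ε),
        16 * ‖y‖ ^ 2 *
          (deriv (fun s : ℝ ↦ Real.exp (-s / (8 * τ)) *
            (Real.smoothTransition (s / (2 * ε ^ 2) - 1) *
              Real.smoothTransition (3 - 4 * s / r' ^ 2))) (‖y‖ ^ 2)) ^ 2) := by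
    rw [mul_div_assoc', le_div_iff₀ h1η] at h1
    nlinarith [mul_le_mul_of_nonneg_left h1 hτ.le]
  -- apply the bookkeeping
  have hk0 : (0 : ℝ) < k := by exact_mod_cast hk
  have hP : (0 : ℝ) < 16 * π ^ 2 * τ ^ 2 := by positivity
  have key := hbook η (L * c) (τ * Λ) (16 * π ^ 2 * τ ^ 2) k _ _ _ J₀ (τ * J₁) J₂ hη0 hηδ
    (by positivity) hLc (by nlinarith) hP hk0 hI0 hI0u hI1 hI2 h0l h0u (by positivity) h1' hJ2 h2
  have hlog : 2 * Real.log (4 * Real.pi * τ) = Real.log (16 * π ^ 2 * τ ^ 2) := by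
    rw [show (16 : ℝ) * π ^ 2 * τ ^ 2 = (4 * π * τ) ^ 2 by ring, Real.log_pow]; push_cast; ring
  rw [hlog]
  linarith

end Summit.SmoothPoincare4.SmoothPoincare4.Theorems.SubcylindricalRecognition.AncientSphereRigidity
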